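import Summits.Ventures.HodgeRepro2.T5SU11ResolventIterateHilbert
import Summits.Ventures.HodgeRepro2.T5SU11KernelNeumannUniform
import Summits.Ventures.HodgeRepro2.T5SU11KernelCornerSingularity
import Summits.Ventures.HodgeRepro2.T5SU11KernelCompositionTaylorUniform
import Summits.Ventures.HodgeRepro2.T5SU11KernelCompositionLipschitzUniform

/-!
# Summary XXV — Hilbert's identity for the powers, and the kernel in the spectral parameter uniformly in `(t, s)` away
from the corner (rows 599–605), under uniform names

Throughout `μ = λ(λ − 2)`, `K_λ` the kernel of `G^I_λ`, `K_λ^{∘(n+1)}(t, s) = (G^I_λ)ⁿ K_λ(·, s)(t)` the composed kernels,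
`Ξ = φ_1` the ground state, `W_1 = {|g| ≤ D Ξ}`, `a > 0` and `{max(t, s) ≥ a}` the region away from the corner.

* `resolvent_sum_range`, `hilbert_identity_powers`, `hilbert_identity_powers'`, `kernel_sub_resolvent`, `hilbert_identity_comp`
  — **`(G^I_λ)ⁿ g − (G^I_{λ₂})ⁿ g = (μ − μ₂) Σ_{j<n} (G^I_λ)^{j+1} (G^I_{λ₂})^{n−j} g` on `W_1`**, and for the composed kernels
  (row 599);
* `exp_neg_le_ground`, `sphDecay_le_exp_of_le`, `kernel_two_sided`, `kernel_two_sided_max`, `kernel_source_uniform` —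
  **`|K_λ(t, s)| ≤ C Ξ(t) Ξ(s)` on `{max(t, s) ≥ a}`**; the kernel sources in `W_1` with the uniform constant `C Ξ(s)` (row 600);
* `kernel_neumann_remainder`, `kernel_neumann_uniform` — **the kernel's Neumann series with a `(t, s)`-uniform remainder and
  uniform convergence on the sharp disc** (row 601);
* `kernel_comp_uniform`, `kernel_lipschitz_uniform`, `kernel_taylor_remainder_uniform`, `kernel_continuous_uniform` — **the
  composed kernels, the Lipschitz bound and the second-order remainder of the kernel uniformly in `(t, s)`; `λ ↦ K_λ`
  continuous in the sup-norm** (row 602);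
* `sphDecay_log_lower`, `sphDecay_tendsto_atTop`, `kernel_diagonal_log`, `kernel_diagonal_tendsto_atBot`,
  `kernel_two_sided_not_global` — **the corner singularity `χ_λ(t) ≥ c log(1/t) → +∞`, `K_λ(t, t) → −∞`; no bound `C Ξ(t) Ξ(s)`
  on all of `(0, ∞)²`** (row 603);
* `kernel_comp_taylor_uniform` — **the Taylor series of the composed kernels converges uniformly on `{max(t, s) ≥ a}`** (row 604);
* `kernel_comp_abs_antitone`, `kernel_comp_mean_value`, `kernel_comp_lipschitz_uniform`, `kernel_comp_continuous_uniform` —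
  **the composed kernels are Lipschitz in `λ` (mean value theorem), uniformly away from the corner** (row 605).

Nothing is claimed about (N).

Blind lane: Mathlib + the HodgeRepro2 prefix only; no sorry; axioms ⊆ {propext, Classical.choice,
Quot.sound}.
-/

namespace Summit.Ventures.HodgeRepro2.T5SU11RadialSummaryXXV

open Filter Topology MeasureTheory
open Set (Ioi Ioc)
open T5SU11Cartan T5SU11SphericalFunction T5SU11SphericalDecay T5SU11RadialGreenKernel T5SU11RadialGreenImproper
  T5SU11ResolventIterateHilbert T5SU11KernelTwoSidedBound T5SU11KernelNeumannUniform T5SU11KernelUniformBounds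
  T5SU11KernelCornerSingularity T5SU11KernelCompositionTaylorUniform T5SU11KernelCompositionLipschitzUniform

section measure

variable [MeasurableSpace Circle] [BorelSpace Circle]

section hilbert_powers

variable {lam lam₂ : ℝ} (hlam : 1 < lam) (hlam₂ : 1 < lam₂)

include hlam in
/-- **Finite additivity of the resolvent on `W_1`** (row 599). -/
theorem resolvent_sum_range (h : ℕ → ℝ → ℝ) (hc : ∀ j, ContinuousOn (h j) (Ioi 0)) (D : ℕ → ℝ)
    (hD : ∀ j, ∀ r, 0 < r → |h j r| ≤ D j * sph 1 (hyp r)) (n : ℕ) {t : ℝ} (ht : 0 < t) :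
    greenSolI (fun t => sph lam (hyp t)) (sphDecay lam) (fun r => ∑ j ∈ Finset.range n, h j r) t
      = ∑ j ∈ Finset.range n, greenSolI (fun t => sph lam (hyp t)) (sphDecay lam) (h j) t :=
  greenSolI_sum_range_ground hlam h hc D hD n ht

include hlam hlam₂ in
/-- **Hilbert's identity for the powers of the resolvent on `W_1`**:
`(G^I_λ)ⁿ g(t) − (G^I_{λ₂})ⁿ g(t) = (μ − μ₂) Σ_{j<n} (G^I_λ)^{j+1} (G^I_{λ₂})^{n−j} g(t)` (row 599). -/
theorem hilbert_identity_powers {g : ℝ → ℝ} (hg : ContinuousOn g (Ioi 0)) {D : ℝ}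
    (hD : ∀ s, 0 < s → |g s| ≤ D * sph 1 (hyp s)) (n : ℕ) {t : ℝ} (ht : 0 < t) :
    ((greenSolI (fun t => sph lam (hyp t)) (sphDecay lam))^[n] g) t
        - ((greenSolI (fun t => sph lam₂ (hyp t)) (sphDecay lam₂))^[n] g) t
      = (lam * (lam - 2) - lam₂ * (lam₂ - 2)) * ∑ j ∈ Finset.range n,
          ((greenSolI (fun t => sph lam (hyp t)) (sphDecay lam))^[j + 1]
            ((greenSolI (fun t => sph lam₂ (hyp t)) (sphDecay lam₂))^[n - j] g)) t :=
  iterate_sub_iterate_eq_sum hlam hlam₂ hg hD n t ht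

include hlam hlam₂ in
/-- Hilbert's identity for the powers with the mixed compositions in the other order (row 599). -/
theorem hilbert_identity_powers' {g : ℝ → ℝ} (hg : ContinuousOn g (Ioi 0)) {D : ℝ}
    (hD : ∀ s, 0 < s → |g s| ≤ D * sph 1 (hyp s)) (n : ℕ) {t : ℝ} (ht : 0 < t) :
    ((greenSolI (fun t => sph lam (hyp t)) (sphDecay lam))^[n] g) t
        - ((greenSolI (fun t => sph lam₂ (hyp t)) (sphDecay lam₂))^[n] g) t
      = (lam * (lam - 2) - lam₂ * (lam₂ - 2)) * ∑ j ∈ Finset.range n,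
          ((greenSolI (fun t => sph lam₂ (hyp t)) (sphDecay lam₂))^[n - j]
            ((greenSolI (fun t => sph lam (hyp t)) (sphDecay lam))^[j + 1] g)) t :=
  iterate_sub_iterate_eq_sum' hlam hlam₂ hg hD n ht

include hlam hlam₂ in
/-- **`K_λ(r, s) − K_{λ₂}(r, s) = (μ − μ₂) G^I_λ K_{λ₂}(·, s)(r)`** (row 599). -/
theorem kernel_sub_resolvent {s : ℝ} (hs : 0 < s) {r : ℝ} (hr : 0 < r) :
    sphGreenKernel lam r s - sphGreenKernel lam₂ r s
      = (lam * (lam - 2) - lam₂ * (lam₂ - 2))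
        * greenSolI (fun t => sph lam (hyp t)) (sphDecay lam) (fun u => sphGreenKernel lam₂ u s) r :=
  kernel_sub_kernel_eq_greenSolI hlam hlam₂ hs hr

include hlam hlam₂ in
/-- **Hilbert's identity for the composed kernels** (row 599). -/
theorem hilbert_identity_comp {s : ℝ} (hs : 0 < s) (n : ℕ) {t : ℝ} (ht : 0 < t) :
    ((greenSolI (fun t => sph lam (hyp t)) (sphDecay lam))^[n] (fun r => sphGreenKernel lam r s)) t
        - ((greenSolI (fun t => sph lam₂ (hyp t)) (sphDecay lam₂))^[n] (fun r => sphGreenKernel lam₂ r s)) t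
      = (lam * (lam - 2) - lam₂ * (lam₂ - 2))
        * ((∑ j ∈ Finset.range n, ((greenSolI (fun t => sph lam (hyp t)) (sphDecay lam))^[j + 1]
            ((greenSolI (fun t => sph lam₂ (hyp t)) (sphDecay lam₂))^[n - j] (fun r => sphGreenKernel lam r s))) t)
          + ((greenSolI (fun t => sph lam₂ (hyp t)) (sphDecay lam₂))^[n]
            (greenSolI (fun t => sph lam (hyp t)) (sphDecay lam) (fun u => sphGreenKernel lam₂ u s))) t) :=
  kernel_comp_sub_eq hlam hlam₂ hs n ht

end hilbert_powers

section two_sided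

/-- **`e^{−t} ≤ Ξ(t)`** for `t ≥ 0` (row 600). -/
theorem exp_neg_le_ground {t : ℝ} (ht : 0 ≤ t) : Real.exp (-t) ≤ sph 1 (hyp t) :=
  exp_neg_le_sph_one ht

variable {lam : ℝ} (hlam : 1 < lam)

include hlam in
/-- **`χ_λ(s) ≤ c e^{−λs}` on `[a, ∞)`** (row 600). -/
theorem sphDecay_le_exp_of_le {a : ℝ} (ha : 0 < a) :
    ∃ c : ℝ, 0 < c ∧ ∀ s, a ≤ s → sphDecay lam s ≤ c * Real.exp (-lam * s) :=
  exists_sphDecay_le_exp_of_le hlam ha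

include hlam in
/-- **The two-sided ground-state bound `|K_λ(t, s)| ≤ C Ξ(t) Ξ(s)`** for `t > 0`, `s ≥ a` (row 600). -/
theorem kernel_two_sided {a : ℝ} (ha : 0 < a) :
    ∃ C : ℝ, 0 < C ∧ ∀ t s, 0 < t → a ≤ s → |sphGreenKernel lam t s| ≤ C * (sph 1 (hyp t) * sph 1 (hyp s)) :=
  exists_abs_kernel_le_mul_sph_one hlam ha

include hlam in
/-- The two-sided bound on `{max(t, s) ≥ a}` (row 600). -/
theorem kernel_two_sided_max {a : ℝ} (ha : 0 < a) :
    ∃ C : ℝ, 0 < C ∧ ∀ t s, 0 < t → 0 < s → a ≤ max t s →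
      |sphGreenKernel lam t s| ≤ C * (sph 1 (hyp t) * sph 1 (hyp s)) :=
  exists_abs_kernel_le_mul_sph_one_of_le_max hlam ha

include hlam in
/-- **The kernel sources `K_λ(·, s)`, `s ≥ a`, lie in `W_1` with the uniform constant `C Ξ(s)`** (row 600). -/
theorem kernel_source_uniform {a : ℝ} (ha : 0 < a) :
    ∃ C : ℝ, 0 < C ∧ ∀ s, a ≤ s → ∀ r, 0 < r → |sphGreenKernel lam r s| ≤ (C * sph 1 (hyp s)) * sph 1 (hyp r) :=
  exists_kernel_source_le_mul_sph_one_uniform hlam ha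

end two_sided

section uniform

variable {lam lam₂ : ℝ} (hlam : 1 < lam) (hlam₂ : 1 < lam₂)

include hlam hlam₂ in
/-- **The kernel's Neumann remainder uniformly on `{max(t, s) ≥ a}`** (row 601). -/
theorem kernel_neumann_remainder {a : ℝ} (ha : 0 < a) :
    ∃ C : ℝ, 0 < C ∧ ∀ t s, 0 < t → 0 < s → a ≤ max t s → ∀ n : ℕ,
      |sphGreenKernel lam t s - ∑ k ∈ Finset.range (n + 2), (lam * (lam - 2) - lam₂ * (lam₂ - 2)) ^ k
          * ((greenSolI (fun t => sph lam₂ (hyp t)) (sphDecay lam₂))^[k] (fun r => sphGreenKernel lam₂ r s)) t|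
        ≤ |lam * (lam - 2) - lam₂ * (lam₂ - 2)| * (C * sph 1 (hyp s) * sph 1 (hyp t) / (lam - 1) ^ 2
          * (|lam * (lam - 2) - lam₂ * (lam₂ - 2)| / (lam₂ - 1) ^ 2) ^ (n + 1)) :=
  exists_kernel_neumann_remainder_le_of_le_max hlam hlam₂ ha

include hlam hlam₂ in
/-- **The kernel's Neumann series converges uniformly on `{max(t, s) ≥ a}` on the sharp disc** (row 601). -/
theorem kernel_neumann_uniform {a : ℝ} (ha : 0 < a)
    (hq : |lam * (lam - 2) - lam₂ * (lam₂ - 2)| < (lam₂ - 1) ^ 2) :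
    TendstoUniformlyOn
      (fun n (p : ℝ × ℝ) => ∑ k ∈ Finset.range n, (lam * (lam - 2) - lam₂ * (lam₂ - 2)) ^ k
        * ((greenSolI (fun t => sph lam₂ (hyp t)) (sphDecay lam₂))^[k] (fun r => sphGreenKernel lam₂ r p.2)) p.1)
      (fun p => sphGreenKernel lam p.1 p.2) atTop {p : ℝ × ℝ | 0 < p.1 ∧ 0 < p.2 ∧ a ≤ max p.1 p.2} :=
  tendstoUniformlyOn_kernel_neumann_of_le_max hlam hlam₂ ha hq

include hlam₂ in
/-- **The composed kernels uniformly on `{max(t, s) ≥ a}`**: `|K_{λ₂}^{∘(n+1)}(t, s)| ≤ C Ξ(s) Ξ(t)/((λ₂ − 1)²)ⁿ` (row 602). -/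
theorem kernel_comp_uniform {a : ℝ} (ha : 0 < a) :
    ∃ C : ℝ, 0 < C ∧ ∀ n : ℕ, ∀ t s, 0 < t → 0 < s → a ≤ max t s →
      |((greenSolI (fun t => sph lam₂ (hyp t)) (sphDecay lam₂))^[n] (fun r => sphGreenKernel lam₂ r s)) t|
        ≤ C * sph 1 (hyp s) * sph 1 (hyp t) / ((lam₂ - 1) ^ 2) ^ n :=
  exists_kernel_comp_le_uniform_of_le_max hlam₂ ha

include hlam₂ in
/-- **The kernel is Lipschitz in `μ` uniformly on `{max(t, s) ≥ a}`**, `C = C(λ₂, a)` for every `λ > 1` (row 602). -/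
theorem kernel_lipschitz_uniform {a : ℝ} (ha : 0 < a) :
    ∃ C : ℝ, 0 < C ∧ ∀ lam, 1 < lam → ∀ t s, 0 < t → 0 < s → a ≤ max t s →
      |sphGreenKernel lam t s - sphGreenKernel lam₂ t s|
        ≤ |lam * (lam - 2) - lam₂ * (lam₂ - 2)| * (C * sph 1 (hyp s) * sph 1 (hyp t) / (lam - 1) ^ 2) :=
  exists_abs_kernel_sub_le_uniform_of_le_max hlam₂ ha

include hlam₂ in
/-- **The second-order Taylor remainder of the kernel uniformly in `(t, s)` with `s ≥ a`** (row 602). -/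
theorem kernel_taylor_remainder_uniform {a : ℝ} (ha : 0 < a) :
    ∃ C : ℝ, 0 < C ∧ ∀ lam, 1 < lam → ∀ t s, 0 < t → a ≤ s →
      |sphGreenKernel lam t s - sphGreenKernel lam₂ t s
        - (lam * (lam - 2) - lam₂ * (lam₂ - 2))
          * ∫ r in Ioi 0, sphGreenKernel lam₂ t r * sphGreenKernel lam₂ r s * Real.sinh (2 * r)|
      ≤ (lam * (lam - 2) - lam₂ * (lam₂ - 2)) ^ 2 * (C * sph 1 (hyp s) * sph 1 (hyp t))
          / ((lam - 1) ^ 2 * (lam₂ - 1) ^ 2) :=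
  exists_abs_kernel_sub_sub_le_uniform hlam₂ ha

include hlam₂ in
/-- **`λ ↦ K_λ` is continuous at `λ₂` uniformly on `{max(t, s) ≥ a}`** (row 602). -/
theorem kernel_continuous_uniform {a : ℝ} (ha : 0 < a) :
    TendstoUniformlyOn (fun lam (p : ℝ × ℝ) => sphGreenKernel lam p.1 p.2) (fun p => sphGreenKernel lam₂ p.1 p.2)
      (𝓝 lam₂) {p : ℝ × ℝ | 0 < p.1 ∧ 0 < p.2 ∧ a ≤ max p.1 p.2} :=
  tendstoUniformlyOn_kernel_nhds hlam₂ ha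

include hlam hlam₂ in
/-- **The Taylor series of the composed kernels converges uniformly on `{max(t, s) ≥ a}` on the sharp disc** (row 604). -/
theorem kernel_comp_taylor_uniform {a : ℝ} (ha : 0 < a)
    (hq : |lam * (lam - 2) - lam₂ * (lam₂ - 2)| < (lam₂ - 1) ^ 2) (n : ℕ) :
    TendstoUniformlyOn
      (fun N (p : ℝ × ℝ) => ∑ k ∈ Finset.range N, (lam * (lam - 2) - lam₂ * (lam₂ - 2)) ^ k * (((n + k).choose k : ℝ)
        * ((greenSolI (fun t => sph lam₂ (hyp t)) (sphDecay lam₂))^[n + k] (fun r => sphGreenKernel lam₂ r p.2)) p.1))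
      (fun p => ((greenSolI (fun t => sph lam (hyp t)) (sphDecay lam))^[n] (fun r => sphGreenKernel lam r p.2)) p.1)
      atTop {p : ℝ × ℝ | 0 < p.1 ∧ 0 < p.2 ∧ a ≤ max p.1 p.2} :=
  tendstoUniformlyOn_kernel_comp_taylor hlam hlam₂ ha hq n

end uniform

section corner

variable {lam : ℝ} (hlam : 1 < lam)

include hlam in
/-- **`χ_λ(t) ≥ c log(1/t)` on `(0, 1)`** (row 603). -/
theorem sphDecay_log_lower : ∃ c : ℝ, 0 < c ∧ ∀ t, 0 < t → t < 1 → c * (-Real.log t) ≤ sphDecay lam t :=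
  sphDecay_ge_neg_log hlam

include hlam in
/-- **`χ_λ(t) → +∞` as `t → 0⁺`** (row 603). -/
theorem sphDecay_tendsto_atTop : Tendsto (sphDecay lam) (𝓝[>] 0) atTop :=
  tendsto_sphDecay_nhdsGT_zero hlam

include hlam in
/-- **`K_λ(t, t) ≤ −c log(1/t)` on `(0, 1)`** (row 603). -/
theorem kernel_diagonal_log : ∃ c : ℝ, 0 < c ∧ ∀ t, 0 < t → t < 1 → sphGreenKernel lam t t ≤ -(c * (-Real.log t)) :=
  kernel_diagonal_le_neg_log hlam

include hlam in
/-- **`K_λ(t, t) → −∞` as `t → 0⁺`** (row 603). -/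
theorem kernel_diagonal_tendsto_atBot : Tendsto (fun t => sphGreenKernel lam t t) (𝓝[>] 0) atBot :=
  tendsto_kernel_diagonal_nhdsGT_zero hlam

include hlam in
/-- **No bound `|K_λ(t, s)| ≤ C Ξ(t) Ξ(s)` holds on all of `(0, ∞)²`** (row 603). -/
theorem kernel_two_sided_not_global :
    ¬ ∃ C : ℝ, ∀ t s, 0 < t → 0 < s → |sphGreenKernel lam t s| ≤ C * (sph 1 (hyp t) * sph 1 (hyp s)) :=
  not_exists_abs_kernel_le_mul_sph_one hlam

end corner

section lipschitz

variable {s : ℝ} (hs : 0 < s)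

include hs in
/-- **`|K_λ^{∘(n+1)}(t, s)|` decreases with `λ`** (row 605). -/
theorem kernel_comp_abs_antitone {lam₀ lam : ℝ} (hlam₀ : 1 < lam₀) (hle : lam₀ ≤ lam) (n : ℕ) {t : ℝ} (ht : 0 < t) :
    |((greenSolI (fun t => sph lam (hyp t)) (sphDecay lam))^[n] (fun r => sphGreenKernel lam r s)) t|
      ≤ |((greenSolI (fun t => sph lam₀ (hyp t)) (sphDecay lam₀))^[n] (fun r => sphGreenKernel lam₀ r s)) t| :=
  abs_kernel_comp_antitone hs hlam₀ hle n ht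

include hs in
/-- **The mean value bound for the composed kernels in `λ`** (row 605). -/
theorem kernel_comp_mean_value {lam lam₂ : ℝ} (hlam : 1 < lam) (hlam₂ : 1 < lam₂) (n : ℕ) {t : ℝ} (ht : 0 < t) :
    |((greenSolI (fun t => sph lam (hyp t)) (sphDecay lam))^[n] (fun r => sphGreenKernel lam r s)) t
        - ((greenSolI (fun t => sph lam₂ (hyp t)) (sphDecay lam₂))^[n] (fun r => sphGreenKernel lam₂ r s)) t|
      ≤ |lam - lam₂| * (2 * (max lam lam₂ - 1) * (n + 1)
        * |((greenSolI (fun t => sph (min lam lam₂) (hyp t)) (sphDecay (min lam lam₂)))^[n + 1]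
          (fun r => sphGreenKernel (min lam lam₂) r s)) t|) :=
  abs_kernel_comp_sub_le hs hlam hlam₂ n ht

include hs in
/-- **The Lipschitz bound of the composed kernels uniformly on `{max(t, s) ≥ a}` and in `λ, λ₂ ≥ λ₁`** (row 605). -/
theorem kernel_comp_lipschitz_uniform {lam₁ : ℝ} (hlam₁ : 1 < lam₁) {a : ℝ} (ha : 0 < a) (n : ℕ) :
    ∃ C : ℝ, 0 < C ∧ ∀ lam lam₂, lam₁ ≤ lam → lam₁ ≤ lam₂ → ∀ t, 0 < t → a ≤ max t s →
      |((greenSolI (fun t => sph lam (hyp t)) (sphDecay lam))^[n] (fun r => sphGreenKernel lam r s)) t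
          - ((greenSolI (fun t => sph lam₂ (hyp t)) (sphDecay lam₂))^[n] (fun r => sphGreenKernel lam₂ r s)) t|
        ≤ |lam - lam₂| * (2 * (max lam lam₂ - 1) * (n + 1) * (C * sph 1 (hyp s) * sph 1 (hyp t))) :=
  exists_abs_kernel_comp_sub_le_uniform hs hlam₁ ha n

/-- **`λ ↦ K_λ^{∘(n+1)}` is continuous at `λ₂` uniformly on `{max(t, s) ≥ a}`** (row 605). -/
theorem kernel_comp_continuous_uniform {lam₂ : ℝ} (hlam₂ : 1 < lam₂) {a : ℝ} (ha : 0 < a) (n : ℕ) :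
    TendstoUniformlyOn
      (fun lam (p : ℝ × ℝ) => ((greenSolI (fun t => sph lam (hyp t)) (sphDecay lam))^[n]
        (fun r => sphGreenKernel lam r p.2)) p.1)
      (fun p => ((greenSolI (fun t => sph lam₂ (hyp t)) (sphDecay lam₂))^[n] (fun r => sphGreenKernel lam₂ r p.2)) p.1)
      (𝓝 lam₂) {p : ℝ × ℝ | 0 < p.1 ∧ 0 < p.2 ∧ a ≤ max p.1 p.2} :=
  tendstoUniformlyOn_kernel_comp_nhds hlam₂ ha n

end lipschitz

end measure

end Summit.Ventures.HodgeRepro2.T5SU11RadialSummaryXXV
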